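import Summits.AnomalousDissipation.AnomalousDissipation.Theses.TwoAndHalfD
import Summits.AnomalousDissipation.AnomalousDissipation.Theorems.TwoAndHalfDTwohalfdThesisLine
import Summits.AnomalousDissipation.AnomalousDissipation.Theorems.TwoAndHalfDTwohalfdThesisStubLiftBudget
import Literature.Analysis.FluidPDE.TwoHalfNavierStokes
import Literature.Analysis.FluidPDE.TwoHalfWeakEuler
import Literature.Analysis.FluidPDE.TorusClassicalLerayHopfProofs

/-!
# Crux `TwoAndHalfD.TwohalfdThesis` (stmt-AnomalousDissipation-0206): the CLASSICAL junction
# `classical steady-source scalar anomaly ⇒ TwohalfdThesis`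

Support file (everything proved; `--supports stmt-AnomalousDissipation-0206`, registered sub-goal
`twohalfdThesis_of_classicalScalarAnomaly` of the line `Sketch` = duhamel-release).  It isolates the part of the line that
does NOT depend on the released-family witness: once SOME steadily forced classical planar Navier–Stokes family `(v_j, p_j)`
(force `g`, viscosities `ν_j → 0`) carries classical solutions `θ_j` of the unit-Prandtl sourced scalar equation
`∂ₜθ + v_j·∇θ = ν_jΔθ + h` on `[0, ∞) × T²` with POINTWISE budgets `∫‖v_j(t)‖² ≤ E`, `‖θ_j(t)‖² ≤ B` (`t ≥ 0`) and the
dissipation floor `⟨ν_j‖∇θ_j‖²⟩ ≥ ε > 0`, the 2½-D lifts `u_j = (v_j, θ_j)∘π` forced by `f = (g, h)∘π` witness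
`TwohalfdThesis` (the lift is classical — `lift_isClassicalNSSolutionOn`, landed — hence global Leray–Hopf from its own initial
slice, `IsClassicalNSSolutionOn.isLerayHopfOn_of_convex`; the budgets lift by the landed `stub_liftBudget`; `x₃`-invariance is
`Torus.twoHalf_add_single`).  This is the corrected, classical-level content of the route's weak-level glue items
14324/14325 (`ScalarLift2halfD`, false as typed by the non-measurable-datum loophole; `ScalarLiftGlue`), and the common
endpoint of both sufficient specs currently pursued for the open core: the released-family mixing witness W of this line
(`Cruxes/TwohalfdThesis/Lines/Sketch.lean`, through the landed D0–D2) and the sector-halving spec S1 of the sibling crux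
`ScalarAnomalySteadySourceFormal` (stmt-0448, line `budgeted-mixer-template`, whose S2–S4 produce exactly this classical package
before downgrading to weak notions).  References: Majda–Bertozzi 2002 §2.3.1 Prop. 2.7; Bruè–De Lellis 2023 §3; Cheskidov 2023
§6 (2½-D lifts); Doering–Foias 2002 §2 (budgets).
-/

noncomputable section

-- D-0017: single-problem summit ⇒ `Summit.AnomalousDissipation.AnomalousDissipation.…`.
set_option linter.dupNamespace false

namespace Summit.AnomalousDissipation.AnomalousDissipation.Theorems.TwohalfdThesis

open MeasureTheory Set Filter Topology
open scoped ENNReal NNReal InnerProductSpace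
open Literature.Analysis.FunctionSpaces Literature.Analysis.FluidPDE
open Summit.AnomalousDissipation.AnomalousDissipation.Theses.TwoAndHalfD

/-- **Classical steady-source scalar anomaly ⇒ `TwohalfdThesis`** (the junction of the crux's lines).  If a smooth
solenoidal mean-zero steady planar force `g` and a smooth mean-zero source `h` admit, along `ν_j → 0`, classical solutions
`(v_j, p_j)` of the planar Navier–Stokes system on `[0, ∞) × T²` and classical solutions `θ_j` of
`∂ₜθ + v_j·∇θ = ν_jΔθ + h` on `[0, ∞)` with `∫‖v_j(t)‖² ≤ E` and `‖θ_j(t)‖²_{L²} ≤ B` for all `t ≥ 0` and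
`ε ≤ limsup_T T⁻¹∫₀ᵀ ν_j‖∇θ_j‖²` (spectral, `toReal`) for some `ε > 0`, then `TwohalfdThesis` holds, witnessed by
`f = (g, h)∘π`, `u_j(t) = (v_j(t), θ_j(t))∘π`, `u₀_j = u_j(0)`: `f` is `x₃`-invariant, smooth, solenoidal and mean zero; each
`u_j` is a classical 3-D solution forced by `f` (`lift_isClassicalNSSolutionOn`), hence global Leray–Hopf
(`isLerayHopfOn_of_convex`), `x₃`-invariant; `meanEnergy u_j ≤ E + B` and `meanDissipation ν_j u_j ≥ ⟨ν_j‖∇θ_j‖²⟩ ≥ ε`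
(`stub_liftBudget`). -/
theorem twohalfdThesis_of_classicalScalarAnomaly :
    (∃ (g : UnitAddTorus (Fin 2) → EuclideanSpace ℝ (Fin 2)) (h : UnitAddTorus (Fin 2) → ℝ),
      Torus.IsSmooth g ∧ Torus.IsDivFree g ∧ Torus.HasZeroMean g ∧ Torus.IsSmooth h ∧ Torus.HasZeroMean h ∧
      ∃ (ν : ℕ → ℝ) (v : ℕ → ℝ → UnitAddTorus (Fin 2) → EuclideanSpace ℝ (Fin 2))
        (p : ℕ → ℝ → UnitAddTorus (Fin 2) → ℝ) (θ : ℕ → ℝ → UnitAddTorus (Fin 2) → ℝ) (E B ε : ℝ),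
        (∀ j, 0 < ν j) ∧ Tendsto ν atTop (𝓝 0) ∧
        (∀ j, Torus.IsClassicalNSSolutionOn (Ici 0) (ν j) (fun _ => g) (v j) (p j)) ∧
        (∀ j, Torus.IsClassicalScalarTransportForcedOn (Ici 0) (ν j) (v j) (fun _ => h) (θ j)) ∧
        (∀ j t, 0 ≤ t → ∫ x, ‖v j t x‖ ^ 2 ≤ E) ∧ (∀ j t, 0 ≤ t → Torus.scalarL2Sq (θ j t) ≤ B) ∧
        0 < ε ∧ (∀ j, ε ≤ longTimeAvgSup (fun t => ν j * (Torus.eScalarGradNormSq (θ j t)).toReal))) →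
    TwohalfdThesis := by
  rintro ⟨g, h, hgs, hgd, hgm, hhs, hhm, ν, v, p, θ, E, B, ε, hν, hν0, hNS, hθ, hE, hB, hε, hDiss⟩
  -- the classical lift, hence global Leray–Hopf from its own initial slice
  have hcl : ∀ j, Torus.IsClassicalNSSolutionOn (Ici 0) (ν j) (fun _ => Torus.twoHalf g h)
      (fun t => Torus.twoHalf (v j t) (θ j t)) (fun t => p j t ∘ Torus.planarProj) := fun j =>
    lift_isClassicalNSSolutionOn _ _ _ _ _ _ (hNS j) (hθ j)
  -- budgets of the lift
  have hBud := fun j => stub_liftBudget (ν j) E B g h (v j) (p j) (θ j) (hν j) hgs hhs (hNS j) (hθ j) (hE j) (hB j)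
  refine ⟨Torus.twoHalf g h, ?_, hgs.twoHalf hhs, hgd.twoHalf h,
    Torus.hasZeroMean_twoHalf hgs.integrable hhs.integrable hgm hhm, ν,
    fun j => Torus.twoHalf (v j 0) (θ j 0), fun j t => Torus.twoHalf (v j t) (θ j t), hν, hν0, ?_, ?_,
    ⟨E + B, fun j => (hBud j).1⟩, ε, hε, fun j => (hDiss j).trans (hBud j).2⟩
  · intro s x
    rw [← Torus.last_two_eq]
    exact Torus.twoHalf_add_single g h s x
  · intro j T hT
    exact (hcl j).isLerayHopfOn_of_convex (convex_Ici 0) hT Icc_subset_Ici_self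
  · intro j t s x
    rw [← Torus.last_two_eq]
    exact Torus.twoHalf_add_single _ _ s x

end Summit.AnomalousDissipation.AnomalousDissipation.Theorems.TwohalfdThesis

end
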